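import Literature.Analysis.SpecialFunctions.ThetaAGM
import HarnessLib

/-!
# Jacobi's quartic theta identity `θ₃⁴ = θ₂⁴ + θ₄⁴` and the theta transformation formula

Sequel of `ThetaAGM.lean` (real nome `|q| < 1`, `θ₃(q) = ∑ q^{n²}`, `θ₄(q) = θ₃(−q)`). We type
Jacobi's `θ₂` at the nome `q⁴` without fractional powers as the ODD PART of `θ₃`:

  `Θ(q) = ∑_{n ∈ ℤ} q^{(2n+1)²} = θ₂(q⁴)` (`thetaOdd`),  `θ₃(q) − θ₄(q) = 2Θ(q)`,

and prove, by the even/odd-sublattice re-indexing of absolutely convergent double sums over `ℤ²`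
already used in `ThetaAGM.lean` (Borwein–Borwein, *Pi and the AGM*, §2.1):

* `thetaThree_sq_sub_thetaFour_sq` : `θ₃(q⁴)² − θ₄(q⁴)² = 2Θ(q²)²`  (i.e. `θ₃² − θ₄² = 2θ₂(q²)²`);
* `thetaOdd_sq`                      : `Θ(q)² = 2Θ(q²)θ₃(q⁸)`        (i.e. `θ₂² = 2θ₂(q²)θ₃(q²)`);
* `jacobi_quartic` : **`θ₃(q⁴)⁴ = θ₄(q⁴)⁴ + Θ(q)⁴`** — Jacobi's "aequatio identica satis abstrusa"
  `θ₃⁴ = θ₂⁴ + θ₄⁴` at the nome `q⁴` (every nome in `[0,1)` is a `q⁴`), from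
  `θ₃⁴ − θ₄⁴ = (θ₃² − θ₄²)(θ₃² + θ₄²) = 2Θ(q²)²·2θ₃(q⁸)² = (Θ(q)²)²`
  (with `θ₃(q⁴)² + θ₄(q⁴)² = 2θ₃(q⁸)²` from `ThetaAGM.lean`); `jacobi_quartic'` is the same with
  `Θ = (θ₃ − θ₄)/2` substituted. (Borwein–Borwein, *Pi and the AGM*, §2.1, derive the same
  doubling formulas and Jacobi's identity (2.1.10) there.)

Also (the even part): `θ₃(q) + θ₄(q) = 2θ₃(q⁴)` (`thetaThree_add_thetaFour`), so that `θ₄` and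
`θ₂(·⁴) = Θ` are combinations of `θ₃` at the nomes `q, q⁴`; whence the **theta transformation
formulas** for `s > 0`: `θ₃(e^{−π/s}) = √s·θ₃(e^{−πs})` (`thetaThree_exp_neg_pi_div`, from the
tree's Poisson-summation identity `gaussLatticeSum_poisson`) and
`θ₂(e^{−π/s}) = Θ(e^{−π/(4s)}) = √s·θ₄(e^{−πs})` (`thetaOdd_exp_neg_pi_div`, a corollary at the
scales `s` and `4s` — no second Poisson summation needed).

This is the identity that turns the Jacobi-free AGM evaluation `K(√(1 − θ₄⁴/θ₃⁴)) = (π/2)θ₃²`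
(`ThetaAGM.lean` + `EllipticKAGM.lean`) into the classical parametrisation `k = θ₂²/θ₃²`,
`k′ = θ₄²/θ₃²`, `k² + k′² = 1`, needed for the nome–modulus inversion `K′/K = −(log q)/π` on the
road to the singular values behind
`Literature.Analysis.FunctionSpaces.BorweinStraubWanZudilin2012_eq_5_3`. No elliptic functions,
no triple product. Mathlib has neither `θ₂/θ₄` of a real nome nor this identity.

## References

* [BorweinBorwein1987] J. M. Borwein, P. B. Borwein, *Pi and the AGM*, Wiley (1987), §2.1
  (theta doubling formulas, Jacobi's identity), §2.2–2.3 (transformation formula).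
* E. T. Whittaker, G. N. Watson, *A Course of Modern Analysis*, 4th ed., §21.2–21.3.
* C. G. J. Jacobi, *Fundamenta Nova* (1829), §40.
-/

noncomputable section

open _root_.Filter _root_.Set Function
open scoped _root_.Topology NNReal

namespace Literature.Analysis.SpecialFunctions

/-! ### The odd part of `θ₃` (`= θ₂(q⁴)`) and Jacobi's quartic identity -/

/-- **The odd part of `θ₃`**: `Θ(q) = ∑_{n ∈ ℤ} q^{(2n+1)²}` — this is `θ₂(q⁴)`, Jacobi's
`θ₂(p) = ∑ p^{(n+1/2)²}` at the nome `p = q⁴`, typed without fractional powers.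
[cite: BorweinBorwein1987, §2.1 (2.1.1)] -/
def thetaOdd (q : ℝ) : ℝ := ∑' n : ℤ, q ^ ((2 * n + 1).natAbs ^ 2)

/-- The odd theta series converges absolutely for `|q| < 1`. [folklore] -/
theorem summable_norm_thetaOddTerm {q : ℝ} (hq : |q| < 1) :
    Summable fun n : ℤ => ‖q ^ ((2 * n + 1).natAbs ^ 2)‖ := by
  refine (summable_abs_pow_natAbs hq).of_nonneg_of_le (fun n => norm_nonneg _) fun n => ?_
  rw [norm_pow, Real.norm_eq_abs]
  refine pow_le_pow_of_le_one (abs_nonneg q) hq.le ?_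
  calc n.natAbs ≤ (2 * n + 1).natAbs := by omega
    _ ≤ (2 * n + 1).natAbs ^ 2 := Nat.le_self_pow two_ne_zero _

/-- The odd theta series converges for `|q| < 1`. [folklore] -/
theorem summable_thetaOddTerm {q : ℝ} (hq : |q| < 1) :
    Summable fun n : ℤ => q ^ ((2 * n + 1).natAbs ^ 2) :=
  (summable_norm_thetaOddTerm hq).of_norm

/-- **`θ₃(q) − θ₄(q) = 2 Θ(q)`** (the even-indexed terms cancel; classically
`θ₃(q) − θ₄(q) = 2θ₂(q⁴)`). [folklore] -/
theorem thetaThree_sub_thetaFour {q : ℝ} (hq : |q| < 1) :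
    thetaThree q - thetaFour q = 2 * thetaOdd q := by
  have hq' : |-q| < 1 := by rwa [abs_neg]
  unfold thetaFour thetaThree thetaOdd
  rw [← (summable_thetaTerm hq).tsum_sub (summable_thetaTerm hq'), ← tsum_mul_left]
  have hinj : Function.Injective fun k : ℤ => 2 * k + 1 := by
    intro a b h; simp only at h; linarith
  have key := hinj.tsum_eq (f := fun n : ℤ => q ^ (n.natAbs ^ 2) - (-q) ^ (n.natAbs ^ 2)) ?_
  · rw [← key]
    congr 1
    funext k
    have ho : Odd ((2 * k + 1).natAbs ^ 2) := by
      rw [← Nat.not_even_iff_odd, even_natAbs_sq_iff, Int.not_even_iff_odd]; exact ⟨k, rfl⟩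
    rw [ho.neg_pow]
    ring
  · intro n hn
    rw [Function.mem_support] at hn
    rcases Int.even_or_odd n with he | ho
    · exfalso
      apply hn
      have he2 : Even (n.natAbs ^ 2) := (even_natAbs_sq_iff n).2 he
      rw [he2.neg_pow]
      ring
    · obtain ⟨k, hk⟩ := ho
      exact ⟨k, hk.symm⟩

/-- Re-indexing by the ODD sublattice: if `F(m,n) = 0` whenever `m + n` is even, then
`∑_{(m,n)} F(m,n) = ∑_{(u,v)} F(u+v+1, u−v)`. [folklore] -/
theorem tsum_eq_tsum_odd_lattice (F : ℤ × ℤ → ℝ) (hF : ∀ m n : ℤ, Even (m + n) → F (m, n) = 0) :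
    ∑' z : ℤ × ℤ, F z = ∑' w : ℤ × ℤ, F (w.1 + w.2 + 1, w.1 - w.2) := by
  symm
  apply Function.Injective.tsum_eq (g := fun w : ℤ × ℤ => (w.1 + w.2 + 1, w.1 - w.2)) (f := F)
  · rintro ⟨u, v⟩ ⟨u', v'⟩ h
    simp only [Prod.mk.injEq] at h
    obtain ⟨h1, h2⟩ := h
    have hu : u = u' := by linarith
    have hv : v = v' := by linarith
    rw [hu, hv]
  · rintro ⟨m, n⟩ hz
    have ho : Odd (m + n) := by
      rw [← Int.not_even_iff_odd]
      intro h
      exact hz (hF m n h)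
    obtain ⟨k, hk⟩ := ho
    refine ⟨(k, k - n), ?_⟩
    simp only [Prod.mk.injEq]
    constructor <;> linarith

/-- The full lattice is the disjoint union of the even and odd sublattices:
`∑_{(m,n)} F = ∑_{(u,v)} F(u+v, u−v) + ∑_{(u,v)} F(u+v+1, u−v)` for summable `F`. [folklore] -/
theorem tsum_eq_tsum_even_add_tsum_odd (F : ℤ × ℤ → ℝ) (hF : Summable F) :
    ∑' z : ℤ × ℤ, F z =
      ∑' w : ℤ × ℤ, F (w.1 + w.2, w.1 - w.2) + ∑' w : ℤ × ℤ, F (w.1 + w.2 + 1, w.1 - w.2) := by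
  classical
  set E : Set (ℤ × ℤ) := {z | Even (z.1 + z.2)} with hE
  have hsplit : ∀ z, F z = E.indicator F z + Eᶜ.indicator F z := fun z => by
    by_cases hz : z ∈ E
    · rw [Set.indicator_of_mem hz, Set.indicator_of_notMem (Set.notMem_compl_iff.2 hz), add_zero]
    · rw [Set.indicator_of_notMem hz, Set.indicator_of_mem (Set.mem_compl hz), zero_add]
  have h1 : ∑' z, E.indicator F z = ∑' w : ℤ × ℤ, F (w.1 + w.2, w.1 - w.2) := by
    rw [tsum_eq_tsum_even_lattice (E.indicator F)]
    · congr 1; funext w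
      apply Set.indicator_of_mem
      show Even (w.1 + w.2 + (w.1 - w.2))
      exact ⟨w.1, by ring⟩
    · intro m n hmn
      exact Set.indicator_of_notMem (show (m, n) ∉ E from hmn) F
  have h2 : ∑' z, Eᶜ.indicator F z = ∑' w : ℤ × ℤ, F (w.1 + w.2 + 1, w.1 - w.2) := by
    rw [tsum_eq_tsum_odd_lattice (Eᶜ.indicator F)]
    · congr 1; funext w
      apply Set.indicator_of_mem
      show ¬ Even (w.1 + w.2 + 1 + (w.1 - w.2))
      rw [Int.not_even_iff_odd]
      exact ⟨w.1, by ring⟩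
    · intro m n hmn
      exact Set.indicator_of_notMem (Set.notMem_compl_iff.2 (show (m, n) ∈ E from hmn)) F
  calc ∑' z, F z = ∑' z, (E.indicator F z + Eᶜ.indicator F z) := tsum_congr hsplit
    _ = ∑' z, E.indicator F z + ∑' z, Eᶜ.indicator F z :=
        (hF.indicator E).tsum_add (hF.indicator Eᶜ)
    _ = _ := by rw [h1, h2]

/-- `4(|u+v+1|² + |u−v|²) = 2|2u+1|² + 2|2v+1|²`. [folklore] -/
theorem natAbs_identity_odd (u v : ℤ) :
    4 * ((u + v + 1).natAbs ^ 2 + (u - v).natAbs ^ 2) =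
      2 * (2 * u + 1).natAbs ^ 2 + 2 * (2 * v + 1).natAbs ^ 2 := by
  have h : ((4 * ((u + v + 1).natAbs ^ 2 + (u - v).natAbs ^ 2) : ℕ) : ℤ) =
      ((2 * (2 * u + 1).natAbs ^ 2 + 2 * (2 * v + 1).natAbs ^ 2 : ℕ) : ℤ) := by
    push_cast [Int.natAbs_sq, sq_abs]; ring
  exact_mod_cast h

/-- `|2(u+v)+1|² + |2(u−v)+1|² = 2|2u+1|² + 8|v|²`. [folklore] -/
theorem natAbs_identity_even' (u v : ℤ) :
    (2 * (u + v) + 1).natAbs ^ 2 + (2 * (u - v) + 1).natAbs ^ 2 =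
      2 * (2 * u + 1).natAbs ^ 2 + 8 * v.natAbs ^ 2 := by
  have h : (((2 * (u + v) + 1).natAbs ^ 2 + (2 * (u - v) + 1).natAbs ^ 2 : ℕ) : ℤ) =
      ((2 * (2 * u + 1).natAbs ^ 2 + 8 * v.natAbs ^ 2 : ℕ) : ℤ) := by
    push_cast [Int.natAbs_sq, sq_abs]; ring
  exact_mod_cast h

/-- `|2(u+v+1)+1|² + |2(u−v)+1|² = 8|u+1|² + 2|2v+1|²`. [folklore] -/
theorem natAbs_identity_odd' (u v : ℤ) :
    (2 * (u + v + 1) + 1).natAbs ^ 2 + (2 * (u - v) + 1).natAbs ^ 2 =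
      8 * (u + 1).natAbs ^ 2 + 2 * (2 * v + 1).natAbs ^ 2 := by
  have h : (((2 * (u + v + 1) + 1).natAbs ^ 2 + (2 * (u - v) + 1).natAbs ^ 2 : ℕ) : ℤ) =
      ((8 * (u + 1).natAbs ^ 2 + 2 * (2 * v + 1).natAbs ^ 2 : ℕ) : ℤ) := by
    push_cast [Int.natAbs_sq, sq_abs]; ring
  exact_mod_cast h

/-- **`θ₃(q⁴)² − θ₄(q⁴)² = 2 Θ(q²)²`** (classically `θ₃² − θ₄² = 2θ₂(q²)²` at the nome `q⁴`;
`|q| < 1`): only `m + n` odd contributes, re-indexed by `(m,n) = (u+v+1, u−v)`,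
`4(m² + n²) = 2(2u+1)² + 2(2v+1)²`. [folklore] -/
theorem thetaThree_sq_sub_thetaFour_sq {q : ℝ} (hq : |q| < 1) :
    thetaThree (q ^ 4) ^ 2 - thetaFour (q ^ 4) ^ 2 = 2 * thetaOdd (q ^ 2) ^ 2 := by
  have hq4 : |q ^ 4| < 1 := by
    rw [abs_pow]; exact pow_lt_one₀ (abs_nonneg q) hq (by norm_num)
  have hq4' : |-q ^ 4| < 1 := by rwa [abs_neg]
  have hq2 : |q ^ 2| < 1 := by
    rw [abs_pow]; exact pow_lt_one₀ (abs_nonneg q) hq two_ne_zero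
  unfold thetaFour
  rw [sq, sq (thetaThree (-q ^ 4)), thetaThree_mul_thetaThree hq4 hq4,
    thetaThree_mul_thetaThree hq4' hq4',
    ← (summable_thetaTerm_prod hq4 hq4).tsum_sub (summable_thetaTerm_prod hq4' hq4'),
    tsum_eq_tsum_odd_lattice _ ?_]
  · -- the odd sublattice
    have hT : thetaOdd (q ^ 2) ^ 2 = ∑' w : ℤ × ℤ,
        (q ^ 2) ^ ((2 * w.1 + 1).natAbs ^ 2) * (q ^ 2) ^ ((2 * w.2 + 1).natAbs ^ 2) := by
      rw [sq]
      exact tsum_mul_tsum_of_summable_norm (f := fun n : ℤ => (q ^ 2) ^ ((2 * n + 1).natAbs ^ 2))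
        (g := fun n : ℤ => (q ^ 2) ^ ((2 * n + 1).natAbs ^ 2))
        (summable_norm_thetaOddTerm hq2) (summable_norm_thetaOddTerm hq2)
    rw [hT, ← tsum_mul_left]
    congr 1
    funext w
    obtain ⟨u, v⟩ := w
    simp only
    have ho : Odd ((u + v + 1).natAbs ^ 2 + (u - v).natAbs ^ 2) := by
      rw [← Nat.not_even_iff_odd, even_natAbs_sq_add_iff, Int.not_even_iff_odd]
      exact ⟨u, by ring⟩
    have e : (q ^ 2) ^ ((2 * u + 1).natAbs ^ 2) * (q ^ 2) ^ ((2 * v + 1).natAbs ^ 2) =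
        (q ^ 4) ^ ((u + v + 1).natAbs ^ 2 + (u - v).natAbs ^ 2) := by
      rw [← pow_mul, ← pow_mul, ← pow_mul, ← pow_add, natAbs_identity_odd]
    rw [← pow_add, ← pow_add, ho.neg_pow, sub_neg_eq_add, ← two_mul, e]
  · intro m n hmn
    simp only
    have he : Even (m.natAbs ^ 2 + n.natAbs ^ 2) := (even_natAbs_sq_add_iff m n).2 hmn
    rw [← pow_add, ← pow_add, he.neg_pow, sub_self]

/-- The even-sublattice half of `Θ(q)²`: `Θ(q²) θ₃(q⁸)`. [folklore] -/
theorem thetaOdd_sq_even_part {q : ℝ} (hq : |q| < 1) :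
    ∑' w : ℤ × ℤ, q ^ ((2 * (w.1 + w.2) + 1).natAbs ^ 2) * q ^ ((2 * (w.1 - w.2) + 1).natAbs ^ 2)
      = thetaOdd (q ^ 2) * thetaThree (q ^ 8) := by
  have hq2 : |q ^ 2| < 1 := by
    rw [abs_pow]; exact pow_lt_one₀ (abs_nonneg q) hq two_ne_zero
  have hq8 : |q ^ 8| < 1 := by
    rw [abs_pow]; exact pow_lt_one₀ (abs_nonneg q) hq (by norm_num)
  rw [thetaOdd, thetaThree,
    tsum_mul_tsum_of_summable_norm (f := fun n : ℤ => (q ^ 2) ^ ((2 * n + 1).natAbs ^ 2))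
      (g := fun n : ℤ => (q ^ 8) ^ (n.natAbs ^ 2))
      (summable_norm_thetaOddTerm hq2) (summable_norm_thetaTerm hq8)]
  congr 1
  funext w
  rw [← pow_mul, ← pow_mul, ← pow_add, ← pow_add, natAbs_identity_even']

/-- The odd-sublattice half of `Θ(q)²`, after the shift `u ↦ u + 1`: `θ₃(q⁸) Θ(q²)`. [folklore] -/
theorem thetaOdd_sq_odd_part {q : ℝ} (hq : |q| < 1) :
    ∑' w : ℤ × ℤ, q ^ ((2 * (w.1 + w.2 + 1) + 1).natAbs ^ 2) * q ^ ((2 * (w.1 - w.2) + 1).natAbs ^ 2)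
      = thetaThree (q ^ 8) * thetaOdd (q ^ 2) := by
  have hq2 : |q ^ 2| < 1 := by
    rw [abs_pow]; exact pow_lt_one₀ (abs_nonneg q) hq two_ne_zero
  have hq8 : |q ^ 8| < 1 := by
    rw [abs_pow]; exact pow_lt_one₀ (abs_nonneg q) hq (by norm_num)
  have hshift : thetaThree (q ^ 8) = ∑' u : ℤ, (q ^ 8) ^ ((u + 1).natAbs ^ 2) := by
    have h := (Equiv.addRight (1 : ℤ)).tsum_eq (fun n : ℤ => (q ^ 8) ^ (n.natAbs ^ 2))
    simp only [Equiv.coe_addRight] at h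
    exact h.symm
  have hshift_s : Summable fun u : ℤ => ‖(q ^ 8) ^ ((u + 1).natAbs ^ 2)‖ :=
    (summable_norm_thetaTerm hq8).comp_injective (add_left_injective (1 : ℤ))
  rw [hshift, thetaOdd,
    tsum_mul_tsum_of_summable_norm (f := fun n : ℤ => (q ^ 8) ^ ((n + 1).natAbs ^ 2))
      (g := fun n : ℤ => (q ^ 2) ^ ((2 * n + 1).natAbs ^ 2)) hshift_s
      (summable_norm_thetaOddTerm hq2)]
  congr 1
  funext w
  rw [← pow_mul, ← pow_mul, ← pow_add, ← pow_add, natAbs_identity_odd']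

/-- **`Θ(q)² = 2 Θ(q²) θ₃(q⁸)`** (classically `θ₂(p)² = 2θ₂(p²)θ₃(p²)` at `p = q⁴`; `|q| < 1`):
split `∑ q^{(2m+1)²+(2n+1)²}` over the even and odd sublattices,
`(2(u+v)+1)² + (2(u−v)+1)² = 2(2u+1)² + 8v²`, `(2(u+v+1)+1)² + (2(u−v)+1)² = 8(u+1)² + 2(2v+1)²`.
[folklore] -/
theorem thetaOdd_sq {q : ℝ} (hq : |q| < 1) :
    thetaOdd q ^ 2 = 2 * thetaOdd (q ^ 2) * thetaThree (q ^ 8) := by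
  have hprod : thetaOdd q ^ 2 =
      ∑' z : ℤ × ℤ, q ^ ((2 * z.1 + 1).natAbs ^ 2) * q ^ ((2 * z.2 + 1).natAbs ^ 2) := by
    rw [sq]
    exact tsum_mul_tsum_of_summable_norm (f := fun n : ℤ => q ^ ((2 * n + 1).natAbs ^ 2))
      (g := fun n : ℤ => q ^ ((2 * n + 1).natAbs ^ 2))
      (summable_norm_thetaOddTerm hq) (summable_norm_thetaOddTerm hq)
  have hsum : Summable fun z : ℤ × ℤ =>
      q ^ ((2 * z.1 + 1).natAbs ^ 2) * q ^ ((2 * z.2 + 1).natAbs ^ 2) :=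
    summable_mul_of_summable_norm (f := fun n : ℤ => q ^ ((2 * n + 1).natAbs ^ 2))
      (g := fun n : ℤ => q ^ ((2 * n + 1).natAbs ^ 2))
      (summable_norm_thetaOddTerm hq) (summable_norm_thetaOddTerm hq)
  rw [hprod, tsum_eq_tsum_even_add_tsum_odd _ hsum, thetaOdd_sq_even_part hq,
    thetaOdd_sq_odd_part hq]
  ring

/-- **Jacobi's quartic identity `θ₃⁴ = θ₄⁴ + θ₂⁴`** at the nome `q⁴`, with `θ₂(q⁴) = Θ(q)` the
odd part of `θ₃(q)`: `θ₃(q⁴)⁴ = θ₄(q⁴)⁴ + Θ(q)⁴` (`|q| < 1`). Proof (Borwein–Borwein §2.1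
style, no elliptic functions): `θ₃⁴ − θ₄⁴ = (θ₃² − θ₄²)(θ₃² + θ₄²) = 2Θ(q²)² · 2θ₃(q⁸)² =
(2Θ(q²)θ₃(q⁸))² = (Θ(q)²)²`. [cite: BorweinBorwein1987, §2.1] -/
theorem jacobi_quartic {q : ℝ} (hq : |q| < 1) :
    thetaThree (q ^ 4) ^ 4 = thetaFour (q ^ 4) ^ 4 + thetaOdd q ^ 4 := by
  have hq4 : |q ^ 4| < 1 := by
    rw [abs_pow]; exact pow_lt_one₀ (abs_nonneg q) hq (by norm_num)
  have h1 := thetaThree_sq_add_thetaFour_sq hq4     -- θ₃(q⁴)² + θ₄(q⁴)² = 2 θ₃(q⁸)²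
  rw [← pow_mul, show 4 * 2 = 8 by norm_num] at h1
  have h2 := thetaThree_sq_sub_thetaFour_sq hq       -- θ₃(q⁴)² − θ₄(q⁴)² = 2 Θ(q²)²
  have h3 := thetaOdd_sq hq                          -- Θ(q)² = 2 Θ(q²) θ₃(q⁸)
  have key : thetaThree (q ^ 4) ^ 4 - thetaFour (q ^ 4) ^ 4 = thetaOdd q ^ 4 := by
    calc thetaThree (q ^ 4) ^ 4 - thetaFour (q ^ 4) ^ 4
          = (thetaThree (q ^ 4) ^ 2 - thetaFour (q ^ 4) ^ 2) *
            (thetaThree (q ^ 4) ^ 2 + thetaFour (q ^ 4) ^ 2) := by ring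
      _ = (2 * thetaOdd (q ^ 2) * thetaThree (q ^ 8)) ^ 2 := by rw [h2, h1]; ring
      _ = thetaOdd q ^ 4 := by rw [← h3]; ring
  linarith

/-- Jacobi's identity in terms of `θ₃, θ₄` alone: `θ₃(q⁴)⁴ = θ₄(q⁴)⁴ + ((θ₃(q) − θ₄(q))/2)⁴`
(`θ₂(q⁴) = (θ₃(q) − θ₄(q))/2`). [folklore] -/
theorem jacobi_quartic' {q : ℝ} (hq : |q| < 1) :
    thetaThree (q ^ 4) ^ 4 = thetaFour (q ^ 4) ^ 4 + ((thetaThree q - thetaFour q) / 2) ^ 4 := by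
  rw [thetaThree_sub_thetaFour hq, jacobi_quartic hq]
  ring


/-! ### The even part of `θ₃` and the theta transformation formula -/

/-- **`θ₃(q) + θ₄(q) = 2 θ₃(q⁴)`** (the odd-indexed terms cancel, the even ones `n = 2k` give
`q^{4k²}`). [folklore] -/
theorem thetaThree_add_thetaFour {q : ℝ} (hq : |q| < 1) :
    thetaThree q + thetaFour q = 2 * thetaThree (q ^ 4) := by
  have hq' : |-q| < 1 := by rwa [abs_neg]
  have hq4 : |q ^ 4| < 1 := by
    rw [abs_pow]; exact pow_lt_one₀ (abs_nonneg q) hq (by norm_num)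
  unfold thetaFour thetaThree
  rw [← (summable_thetaTerm hq).tsum_add (summable_thetaTerm hq'), ← tsum_mul_left]
  have hinj : Function.Injective fun k : ℤ => 2 * k := by
    intro a b h; simp only at h; linarith
  have key := hinj.tsum_eq (f := fun n : ℤ => q ^ (n.natAbs ^ 2) + (-q) ^ (n.natAbs ^ 2)) ?_
  · rw [← key]
    congr 1
    funext k
    have he : Even ((2 * k).natAbs ^ 2) := by
      rw [even_natAbs_sq_iff]; exact ⟨k, by ring⟩
    have hk : (2 * k).natAbs ^ 2 = 4 * k.natAbs ^ 2 := by
      have h : (((2 * k).natAbs ^ 2 : ℕ) : ℤ) = ((4 * k.natAbs ^ 2 : ℕ) : ℤ) := by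
        push_cast [Int.natAbs_sq, sq_abs]; ring
      exact_mod_cast h
    rw [he.neg_pow, hk, pow_mul]
    ring
  · intro n hn
    rw [Function.mem_support] at hn
    rcases Int.even_or_odd n with he | ho
    · obtain ⟨k, hk⟩ := he
      exact ⟨k, by simp only; rw [hk]; ring⟩
    · exfalso
      apply hn
      have ho2 : Odd (n.natAbs ^ 2) := by
        rw [← Nat.not_even_iff_odd, even_natAbs_sq_iff, Int.not_even_iff_odd]; exact ho
      rw [ho2.neg_pow]
      ring

/-- `θ₄ = 2θ₃(q⁴) − θ₃(q)` and `θ₂(q⁴) = Θ(q) = θ₃(q) − θ₃(q⁴)`: both are combinations of `θ₃`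
at the nomes `q` and `q⁴`. [folklore] -/
theorem thetaOdd_eq_thetaThree_sub {q : ℝ} (hq : |q| < 1) :
    thetaOdd q = thetaThree q - thetaThree (q ^ 4) := by
  have h1 := thetaThree_sub_thetaFour hq
  have h2 := thetaThree_add_thetaFour hq
  linarith

/-- **Theta transformation formula for `θ₃`** (Poisson summation; the tree's
`gaussLatticeSum_poisson`): for `s > 0`, `θ₃(e^{−π/s}) = √s · θ₃(e^{−πs})`.
[cite: BorweinBorwein1987, §2.2–2.3] -/
theorem thetaThree_exp_neg_pi_div {s : ℝ} (hs : 0 < s) :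
    thetaThree (Real.exp (-(Real.pi / s))) = Real.sqrt s * thetaThree (Real.exp (-(Real.pi * s))) := by
  have hπ := Real.pi_pos
  have h := gaussLatticeSum_poisson (c := Real.pi * s) (by positivity)
  rw [gaussLatticeSum_eq_thetaThree, gaussLatticeSum_eq_thetaThree,
    show Real.pi ^ 2 / (Real.pi * s) = Real.pi / s by field_simp,
    show Real.pi / (Real.pi * s) = s⁻¹ by field_simp, Real.sqrt_inv] at h
  -- h : θ₃(e^{-πs}) = (√s)⁻¹ θ₃(e^{-π/s})
  have hs' : Real.sqrt s ≠ 0 := (Real.sqrt_pos.2 hs).ne'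
  rw [h]
  field_simp

/-- **Theta transformation formula for `θ₄ ↔ θ₂`**: for `s > 0`,
`θ₂(e^{−π/s}) = √s · θ₄(e^{−πs})`, with `θ₂(e^{−π/s}) = Θ(e^{−π/(4s)})` the odd part of `θ₃`.
Proof: `θ₄ = 2θ₃(·⁴) − θ₃`, `Θ = θ₃ − θ₃(·⁴)` and the `θ₃` formula at the scales `s` and `4s`.
[cite: BorweinBorwein1987, §2.2–2.3] -/
theorem thetaOdd_exp_neg_pi_div {s : ℝ} (hs : 0 < s) :
    thetaOdd (Real.exp (-(Real.pi / (4 * s)))) =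
      Real.sqrt s * thetaFour (Real.exp (-(Real.pi * s))) := by
  have hπ := Real.pi_pos
  set Q := Real.exp (-(Real.pi * s)) with hQ
  set q' := Real.exp (-(Real.pi / (4 * s))) with hq'
  have hQ1 : |Q| < 1 := by
    rw [abs_of_pos (Real.exp_pos _), Real.exp_lt_one_iff]
    have : 0 < Real.pi * s := by positivity
    linarith
  have hq'1 : |q'| < 1 := by
    rw [abs_of_pos (Real.exp_pos _), Real.exp_lt_one_iff]
    have : 0 < Real.pi / (4 * s) := by positivity
    linarith
  -- the four theta values as `f(σ) = θ₃(e^{-πσ})`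
  have e1 : q' ^ 4 = Real.exp (-(Real.pi / s)) := by
    rw [hq', ← Real.exp_nat_mul]; congr 1; field_simp; ring
  have e2 : Q ^ 4 = Real.exp (-(Real.pi * (4 * s))) := by
    rw [hQ, ← Real.exp_nat_mul]; congr 1; ring
  have d1 := thetaThree_exp_neg_pi_div hs                        -- scale s
  have d4 := thetaThree_exp_neg_pi_div (s := 4 * s) (by positivity) -- scale 4s
  rw [thetaOdd_eq_thetaThree_sub hq'1, e1, hq', d4, d1]
  have h4 : thetaFour Q = 2 * thetaThree (Q ^ 4) - thetaThree Q := by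
    have := thetaThree_add_thetaFour hQ1; linarith
  rw [h4, e2]
  have hsqrt : Real.sqrt (4 * s) = 2 * Real.sqrt s := by
    rw [Real.sqrt_mul (by norm_num : (0:ℝ) ≤ 4), show (4:ℝ) = 2 ^ 2 by norm_num,
      Real.sqrt_sq (by norm_num : (0:ℝ) ≤ 2)]
  rw [hsqrt]
  ring


end Literature.Analysis.SpecialFunctions

end
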